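import Mathlib
import Summits.Schanuel.Schanuel.Theorems.AclSubsetLogFreeCore.Negative.LogFreeCoreObjects
import Literature.NumberTheory.Transcendental.LindemannWeierstrassProofs
import Literature.Barriers.Schanuel.AlgebraicIndependenceOfLogarithms
import Literature.Barriers.Schanuel.LargeTranscendenceDegreeSmallTrdegProofs
import Literature.Barriers.Schanuel.NesterenkoModularScopeConjectureProofs

/-!
# Line `kernel-tower-relative-lw` of crux `RigidCore.SchanuelOnLogFreeCore`: the exceptional line of `RelLW₀`

Crux `stmt-Schanuel-0970` (`Summit.Schanuel.Schanuel.Theses.RigidCore.SchanuelOnLogFreeCore`,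
Schanuel's conjecture on the log-free core `C_EA`), line `kernel-tower-relative-lw`, registered
stub `stub_expExceptionalLine`.  The line's level-`0` layer `RelLW₀` at rank `r = 1` says: for
`a ∈ L₀ ∖ ℚ·2πi`, where `L₀ = stage 0 = ℚ(2πi)^{ralg}`
(`Summit.Schanuel.Schanuel.Theorems.AclSubsetLogFreeCore.Negative.stage`), `e^a ∉ L₀`.  On the
ALGEBRAIC sector `a = α ∈ ℚ̄` this reads "`e^α` is transcendental over `ℚ(π)`", which is open on
the axes (`α = 1` is `e ⊥ π`).  This file proves the **exceptional-line theorem**: the algebraic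
`α` with `e^α ∈ L₀` span at most ONE `ℚ`-line — for `ℚ`-linearly independent algebraic `α, β`,
`e^α` and `e^β` are not both in `L₀` (indeed not both algebraic over `ℚ(π)`).

Proof (Lindemann–Weierstrass + a transcendence-degree count).  Elements of `L₀` are algebraic
over `ℚ(2πi) ≤ ℚ(π)^{ralg}`, hence over `ℚ(π)`.  If `e^α, e^β` were both algebraic over `ℚ(π)`
then `trdeg_ℚ ℚ(π, e^α, e^β) = trdeg_ℚ ℚ(π) ≤ 1` (relative tower law
`Literature.Barriers.Schanuel.trdeg_adjoin_union_eq_of_isAlgebraic_adjoin` and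
`trdeg_adjoin_singleton_le_one`).  But `α, β` are `ℚ`-linearly independent algebraic numbers, so
by Lindemann–Weierstrass (PROVED tree theorem
`Literature.NumberTheory.Transcendental.algebraicIndependent_exp_holds`; A. Baker,
*Transcendental Number Theory* (1975), Ch. 1 §3, remark after Theorem 1.4) `e^α, e^β` are
algebraically independent over `ℚ`, and the same field has `trdeg ≥ 2`: contradiction.

## Main statements (namespace `Summit.Schanuel.Schanuel.Theorems.RigidCore`)

* `KernelTower.not_isAlgebraic_adjoin_pi_exp_pair` — for `ℚ`-linearly independent algebraic
  `α, β`: `e^α, e^β` are **not both algebraic over `ℚ(π)`**;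
* `KernelTower.not_mem_Kpi_exp_pair` — the same over `Kpi = ℚ(π)^{ralg}`;
* `stub_expExceptionalLine` — the registered stub, signature verbatim:
  `e^α ∈ stage 0 → e^β ∉ stage 0`;
* `KernelTower.not_linearIndependent_of_exp_mem_stage_zero` — "at most one `ℚ`-line": algebraic
  `α, β` with `e^α, e^β ∈ L₀` are `ℚ`-linearly dependent;
* `KernelTower.exp_mem_stage_zero_unique` — tuple form: for `ℚ`-linearly independent algebraic
  `u : Fin r → ℂ`, at most one index `i` has `e^{u i} ∈ L₀`;
* `KernelTower.algebraicIndependent_pi_pair_iff` — `π ⊥ y ↔ y` transcendental over `ℚ(π)`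
  (Lindemann's `transcendental_pi_holds` + `AlgebraicIndependent.option_iff`);
* `KernelTower.algebraicIndependent_pi_exp_or` — the **dichotomy** (route ExceptionalLines'
  `ExceptionalLineDichotomy` at `η = π`): for `ℚ`-linearly independent algebraic `α, β`,
  `π ⊥ e^α` or `π ⊥ e^β`.  Instances: at least one of `e ⊥ π`, `π ⊥ e^{√2}`; at least one of
  `e ⊥ π`, `π ⊥ e^{i}`.

Helpers live in the sub-namespace `ExpExceptionalLine` (local to this file, which imports only
accepted base modules): `two_le_trdeg_of_algebraicIndependent_pair_mem` (an algebraically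
independent pair inside an intermediate field forces `trdeg ≥ 2`), `algebraicIndependent_exp_pair`
(Lindemann–Weierstrass on a pair), and the two directions of `algebraicIndependent_pi_pair_iff`.
The facts "elements of `L₀` are algebraic over `ℚ(π)`" and "`π` is transcendental in `ℂ`" are
re-proved inline (three lines each; the former after
`RelLWZeroOffAxes.isAlgebraic_adjoin_pi_of_mem_stage_zero` of the sibling stub file
`…RigidCoreSchanuelOnLogFreeCoreRelLWZeroOffAxes` of this line, whose module was not yet built on
the farm when this file was written — for the same reason `KernelTower.stage_zero_eq_Kpi` of
`…RelLWZeroRatPi` is not used; the latter is the two-line argument of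
`CalibrationR.transcendental_pi_complex`).

NOT here: anything on which line is the exceptional one (`α = 1`, i.e. `e ⊥ π`, is open); the
neighbouring stubs of the line (`stub_relLWZero_of_schanuelOnStageZero`,
`stub_sixExponentialsStageZero`, `stub_relLWZero`, `stub_relLWStep`) are neither proved nor used.

## References

* [BakerTNT1975] A. Baker, *Transcendental Number Theory*, Cambridge University Press (1975),
  Ch. 1 §3, Theorem 1.4 and the remark following it (Lindemann–Weierstrass), p. 6; Theorem 1.3
  (Lindemann, `π` transcendental), p. 5.
-/

noncomputable section

namespace Summit.Schanuel.Schanuel.Theorems.RigidCore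

open IntermediateField
open Literature.NumberTheory.Transcendental
open Literature.Barriers.Schanuel
open Summit.Schanuel.Schanuel.Theorems.AclSubsetLogFreeCore.Negative

namespace ExpExceptionalLine

/-! ## Helpers -/

/-- An algebraically independent pair lying in an intermediate field `L` of `ℂ/ℚ` forces
`trdeg_ℚ L ≥ 2`. [folklore] -/
theorem two_le_trdeg_of_algebraicIndependent_pair_mem {L : IntermediateField ℚ ℂ} {a b : ℂ}
    (h : AlgebraicIndependent ℚ ![a, b]) (ha : a ∈ L) (hb : b ∈ L) :
    ((2 : ℕ) : Cardinal) ≤ Algebra.trdeg ℚ L := by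
  have hmem : ∀ i, ![a, b] i ∈ L := fun i => by fin_cases i; exacts [ha, hb]
  let y' : Fin 2 → L := fun i => ⟨![a, b] i, hmem i⟩
  have hy' : AlgebraicIndependent ℚ y' := AlgebraicIndependent.of_comp L.val (by exact h)
  simpa using hy'.cardinalMk_le_trdeg

/-- **Lindemann–Weierstrass on a pair**: for `ℚ`-linearly independent algebraic `α, β`, the
numbers `e^α, e^β` are algebraically independent over `ℚ` (tree theorem
`algebraicIndependent_exp_holds`). [cite: BakerTNT1975, Ch. 1 Thm 1.4] -/
theorem algebraicIndependent_exp_pair {α β : ℂ} (hα : IsAlgebraic ℚ α) (hβ : IsAlgebraic ℚ β)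
    (hli : LinearIndependent ℚ ![α, β]) :
    AlgebraicIndependent ℚ ![Complex.exp α, Complex.exp β] := by
  have halg : ∀ i, IsAlgebraic ℚ (![α, β] i) := by
    intro i
    fin_cases i
    · exact hα
    · exact hβ
  have h := algebraicIndependent_exp_holds (![α, β]) halg hli
  convert h using 1
  ext i
  fin_cases i <;> rfl

/-! ## `π ⊥ y` versus `y` transcendental over `ℚ(π)` -/

/-- If `y` is transcendental over `ℚ(π)` then `π, y` are algebraically independent over `ℚ`
(`π` is transcendental — Lindemann, tree theorem `transcendental_pi_holds`;
`AlgebraicIndependent.option_iff`). [cite: BakerTNT1975, Ch. 1 Thm 1.3] -/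
theorem algebraicIndependent_pi_pair_of_transcendental {y : ℂ}
    (hy : Transcendental (adjoin ℚ ({(Real.pi : ℂ)} : Set ℂ)) y) :
    AlgebraicIndependent ℚ ![(Real.pi : ℂ), y] := by
  have hπ : Transcendental ℚ (Real.pi : ℂ) := fun h =>
    transcendental_pi_holds ((isAlgebraic_algebraMap_iff (A := ℂ) Complex.ofReal_injective).mp h)
  have h1 : AlgebraicIndependent ℚ ![(Real.pi : ℂ)] :=
    algebraicIndependent_iff_transcendental.2 hπ
  have h2 : Transcendental (Algebra.adjoin ℚ (Set.range ![(Real.pi : ℂ)])) y := by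
    rw [Matrix.range_cons_empty, ← IntermediateField.transcendental_adjoin_iff]
    exact hy
  have h := (AlgebraicIndependent.option_iff (x := ![(Real.pi : ℂ)]) (a := y)).2 ⟨h1, h2⟩
  have e : (![(Real.pi : ℂ), y]) =
      (fun o : Option (Fin 1) => o.elim y ![(Real.pi : ℂ)]) ∘ ![some 0, none] := by
    ext i
    fin_cases i <;> rfl
  rw [e]
  exact h.comp _ (fun i j hij => by fin_cases i <;> fin_cases j <;> simp_all)

/-- If `π, y` are algebraically independent over `ℚ` then `y` is transcendental over `ℚ(π)`
(`AlgebraicIndependent.transcendental_adjoin`). [folklore] -/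
theorem transcendental_adjoin_pi_of_algebraicIndependent_pair {y : ℂ}
    (h : AlgebraicIndependent ℚ ![(Real.pi : ℂ), y]) :
    Transcendental (adjoin ℚ ({(Real.pi : ℂ)} : Set ℂ)) y := by
  have ht := h.transcendental_adjoin (s := {0}) (i := 1) (by simp)
  have hs : ((![(Real.pi : ℂ), y]) '' ({0} : Set (Fin 2))) = {(Real.pi : ℂ)} := by simp
  rw [hs] at ht
  rw [IntermediateField.transcendental_adjoin_iff]
  simpa using ht

end ExpExceptionalLine

open ExpExceptionalLine

/-- **`π ⊥ y` iff `y` is transcendental over `ℚ(π)`** (`π` being transcendental, Lindemann).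
[cite: BakerTNT1975, Ch. 1 Thm 1.3] -/
theorem KernelTower.algebraicIndependent_pi_pair_iff {y : ℂ} :
    AlgebraicIndependent ℚ ![(Real.pi : ℂ), y] ↔
      Transcendental (IntermediateField.adjoin ℚ {(Real.pi : ℂ)}) y :=
  ⟨transcendental_adjoin_pi_of_algebraicIndependent_pair,
    algebraicIndependent_pi_pair_of_transcendental⟩

/-! ## The exceptional-line theorem -/

/-- **`e^α, e^β` are not both algebraic over `ℚ(π)`** for `ℚ`-linearly independent algebraic
`α, β`: otherwise `trdeg_ℚ ℚ(π, e^α, e^β) = trdeg_ℚ ℚ(π) ≤ 1`, against `trdeg ≥ 2` from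
Lindemann–Weierstrass (`e^α ⊥ e^β`). [cite: BakerTNT1975, Ch. 1 Thm 1.4] -/
theorem KernelTower.not_isAlgebraic_adjoin_pi_exp_pair (α β : ℂ) (hα : IsAlgebraic ℚ α)
    (hβ : IsAlgebraic ℚ β) (hli : LinearIndependent ℚ ![α, β]) :
    ¬ (IsAlgebraic (IntermediateField.adjoin ℚ {(Real.pi : ℂ)}) (Complex.exp α) ∧
        IsAlgebraic (IntermediateField.adjoin ℚ {(Real.pi : ℂ)}) (Complex.exp β)) := by
  rintro ⟨ha, hb⟩
  set T : Set ℂ := {Complex.exp α, Complex.exp β} with hT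
  have hTalg : ∀ x ∈ T, IsAlgebraic (adjoin ℚ ({(Real.pi : ℂ)} : Set ℂ)) x := by
    rintro x (rfl | rfl)
    exacts [ha, hb]
  have hup : Algebra.trdeg ℚ (adjoin ℚ (({(Real.pi : ℂ)} : Set ℂ) ∪ T)) ≤ 1 :=
    (trdeg_adjoin_union_eq_of_isAlgebraic_adjoin _ T hTalg).trans_le
      (trdeg_adjoin_singleton_le_one _)
  have hlow :
      ((2 : ℕ) : Cardinal) ≤ Algebra.trdeg ℚ (adjoin ℚ (({(Real.pi : ℂ)} : Set ℂ) ∪ T)) :=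
    two_le_trdeg_of_algebraicIndependent_pair_mem (algebraicIndependent_exp_pair hα hβ hli)
      (subset_adjoin ℚ _ (Or.inr (by simp [hT]))) (subset_adjoin ℚ _ (Or.inr (by simp [hT])))
  have := hlow.trans hup
  norm_num at this

/-- **`e^α, e^β` are not both in `Kpi = ℚ(π)^{ralg}`** for `ℚ`-linearly independent algebraic
`α, β`. [cite: BakerTNT1975, Ch. 1 Thm 1.4] -/
theorem KernelTower.not_mem_Kpi_exp_pair (α β : ℂ) (hα : IsAlgebraic ℚ α)
    (hβ : IsAlgebraic ℚ β) (hli : LinearIndependent ℚ ![α, β]) :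
    ¬ (Complex.exp α ∈ Kpi ∧ Complex.exp β ∈ Kpi) := by
  rintro ⟨ha, hb⟩
  rw [Kpi, mem_relAlg_iff] at ha hb
  exact KernelTower.not_isAlgebraic_adjoin_pi_exp_pair α β hα hβ hli ⟨ha, hb⟩

/-- **Stub `stub_expExceptionalLine` of line `kernel-tower-relative-lw`** (registered signature):
the algebraic `α` with `e^α ∈ L₀ = stage 0 = ℚ(2πi)^{ralg}` span at most one `ℚ`-line — for
`ℚ`-linearly independent algebraic `α, β` with `e^α ∈ stage 0`, `e^β ∉ stage 0` (elements of
`stage 0` are algebraic over `ℚ(π)`; then `KernelTower.not_isAlgebraic_adjoin_pi_exp_pair`,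
i.e. Lindemann–Weierstrass plus a transcendence-degree count). [cite: BakerTNT1975, Ch. 1 Thm 1.4] -/
theorem stub_expExceptionalLine :
    ∀ α β : ℂ, IsAlgebraic ℚ α → IsAlgebraic ℚ β → LinearIndependent ℚ ![α, β] →
      Complex.exp α ∈ stage 0 → Complex.exp β ∉ stage 0 := by
  intro α β hα hβ hli hαs hβs
  -- elements of `stage 0 = ℚ(2πi)^{ralg}` are algebraic over `ℚ(2πi) ≤ Kpi = ℚ(π)^{ralg}`,
  -- hence (relative algebraic closedness of `Kpi`) algebraic over `ℚ(π)`
  have hle : adjoin ℚ ({(2 * (Real.pi : ℂ) * Complex.I : ℂ)} : Set ℂ) ≤ Kpi :=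
    adjoin_le_iff.mpr (Set.singleton_subset_iff.mpr two_pi_I_mem_Kpi)
  have key : ∀ w : ℂ, w ∈ stage 0 → IsAlgebraic (adjoin ℚ ({(Real.pi : ℂ)} : Set ℂ)) w := by
    intro w hw
    have h1 : IsAlgebraic (adjoin ℚ ({(2 * (Real.pi : ℂ) * Complex.I : ℂ)} : Set ℂ)) w :=
      mem_relAlg_iff.1 hw
    exact mem_relAlg_iff.1 (relAlg_closed (adjoin ℚ ({(Real.pi : ℂ)} : Set ℂ)) w
      (isAlgebraic_of_le hle h1))
  exact KernelTower.not_isAlgebraic_adjoin_pi_exp_pair α β hα hβ hli ⟨key _ hαs, key _ hβs⟩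

/-- **At most one `ℚ`-line of exceptions**: algebraic `α, β` with `e^α, e^β ∈ L₀ = stage 0` are
`ℚ`-linearly dependent. [cite: BakerTNT1975, Ch. 1 Thm 1.4] -/
theorem KernelTower.not_linearIndependent_of_exp_mem_stage_zero (α β : ℂ) (hα : IsAlgebraic ℚ α)
    (hβ : IsAlgebraic ℚ β) (hαs : Complex.exp α ∈ stage 0) (hβs : Complex.exp β ∈ stage 0) :
    ¬ LinearIndependent ℚ ![α, β] := fun hli =>
  stub_expExceptionalLine α β hα hβ hli hαs hβs

/-- **Tuple form**: for `ℚ`-linearly independent algebraic `u : Fin r → ℂ`, at most one index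
`i` has `e^{u i} ∈ L₀ = stage 0`. [cite: BakerTNT1975, Ch. 1 Thm 1.4] -/
theorem KernelTower.exp_mem_stage_zero_unique {r : ℕ} (u : Fin r → ℂ)
    (hu : ∀ i, IsAlgebraic ℚ (u i)) (hli : LinearIndependent ℚ u) {i j : Fin r}
    (hi : Complex.exp (u i) ∈ stage 0) (hj : Complex.exp (u j) ∈ stage 0) : i = j := by
  by_contra hij
  have hinj : Function.Injective ![i, j] := fun a b hab => by
    fin_cases a <;> fin_cases b <;> simp_all [Ne.symm hij]
  have h2 : LinearIndependent ℚ ![u i, u j] := by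
    have h := hli.comp (![i, j]) hinj
    have e : u ∘ ![i, j] = ![u i, u j] := by
      funext a
      fin_cases a <;> rfl
    rwa [e] at h
  exact stub_expExceptionalLine (u i) (u j) (hu i) (hu j) h2 hi hj

/-! ## The dichotomy `π ⊥ e^α ∨ π ⊥ e^β` -/

/-- **Exceptional-line dichotomy at `η = π`**: for `ℚ`-linearly independent algebraic `α, β`,
`π ⊥ e^α` or `π ⊥ e^β` (`AlgebraicIndependent ℚ ![π, e^α] ∨ AlgebraicIndependent ℚ ![π, e^β]`).
Instances: (`α = 1`, `β = √2`) at least one of `e ⊥ π`, `π ⊥ e^{√2}`; (`α = 1`, `β = i`) at least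
one of `e ⊥ π`, `π ⊥ e^{i}`.  This is route ExceptionalLines' `ExceptionalLineDichotomy` at
`η = π`. [cite: BakerTNT1975, Ch. 1 Thm 1.4] -/
theorem KernelTower.algebraicIndependent_pi_exp_or (α β : ℂ) (hα : IsAlgebraic ℚ α)
    (hβ : IsAlgebraic ℚ β) (hli : LinearIndependent ℚ ![α, β]) :
    AlgebraicIndependent ℚ ![(Real.pi : ℂ), Complex.exp α] ∨
      AlgebraicIndependent ℚ ![(Real.pi : ℂ), Complex.exp β] := by
  by_cases h : IsAlgebraic (adjoin ℚ ({(Real.pi : ℂ)} : Set ℂ)) (Complex.exp α)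
  · refine Or.inr (algebraicIndependent_pi_pair_of_transcendental fun h' => ?_)
    exact KernelTower.not_isAlgebraic_adjoin_pi_exp_pair α β hα hβ hli ⟨h, h'⟩
  · exact Or.inl (algebraicIndependent_pi_pair_of_transcendental h)

end Summit.Schanuel.Schanuel.Theorems.RigidCore
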